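import Summits.BirchSwinnertonDyer.Rank1Residual.GaloisImage.KolyvaginCoreTransport
import Summits.BirchSwinnertonDyer.Rank1Residual.GaloisImage.KummerSelfDualCount
import Summits.BirchSwinnertonDyer.Rank1Residual.GaloisImage.KolyvaginDeepDatum
import Summits.BirchSwinnertonDyer.Rank1Residual.GaloisImage.KolyvaginPrimeLocalShapeRatHolds
import Summits.BirchSwinnertonDyer.Rank1Residual.GaloisImage.PrimeChoiceSakamotoDeep
import Summits.BirchSwinnertonDyer.Rank1Residual.GaloisImage.InflationRestrictionSakamotoH3
import Summits.BirchSwinnertonDyer.Rank1Residual.GaloisImage.KolyvaginDeepSubclassTransport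
import HarnessLib

/-!
# Route `KimAtThreeKolyvagin` (rung W2), crux `DeepUpperAtThree`: RESIDUAL CORE VERTICES of the
# classical structure `𝓚` on `E[3]` inside the DEEP Frobenius class — the `m = 1` half of the
# GOOD-CORE-VERTEX port of `EndRow.deepUpper_conclusion_of_endCoreInputs`

Cell `bsd-addord`, seat `bsd-addord-w2-c3` (D-0074 row B6), item `stmt-BirchSwinnertonDyer-19076`.
TOOL theorems (no definition, no named fact, no `sorry`); nothing asserted about any curve beyond the
stated hypotheses; crux 19076 stays OPEN.

WHY.  The predecessor file `KimAtThreeDeepUpperEndRow.lean` (p425782) reduces crux 19076 at a row to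
per-depth END-core inputs, among them ONE "good core vertex" `d` of the deep datum at depth `k`:
`Λ ∘ loc_{v₃}` injective on `H¹_{𝓕_can(d)}(ℚ, E[3^{k+1}])`, the generator's class `g d` of order
`3^{k+1}`, `ν(d) ≤ B` with `B` INDEPENDENT of the depth.  Both requirements follow from the vanishing
of the classical (Kummer) Selmer group at level `d`, `H¹_{𝓚(d)}(ℚ, E[3^{k+1}]) = 0`, and — 𝓚 being
cartesian — that vanishing follows from the RESIDUAL one `H¹_{𝓚(d)}(ℚ, E[3]) = 0` (Mazur–Rubin's
device: a prime-by-prime induction at modulus `3^{k+1}` does NOT decrease `#H¹_{𝓚(d)}(ℚ, E[3^{k+1}])`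
in general, e.g. `Ш[3^∞] = (ℤ/3)²`; only the residual dimension drops).  This file is the residual
half, at `m = 1`, with the uniform bound:
* §1 `CoreVertex.exists_isLevel_selmerGroup_eq_bot_of_hasCoreRank_zero` — generic `K`, `T̄` killed
  by `p`, a Selmer structure of CORE RANK ZERO, a Kolyvagin datum with Rubin's local shape at its
  primes and the mixed prime choice `hprime` (Rubin Prop. 2.7.1): above every level `n` there is a
  level `d ⊇ n` with `H¹_{𝓕(d)}(K, T̄) = 0 = H¹_{𝓕(d)^*}(K, T̄^D)` and
  `#d + 1 ≤ #n + #H¹_{𝓕(n)^*}(K, T̄^D)` (Rubin Cor. 2.7.3 at `χ = 0`: while `H^*(n) ≠ 0` also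
  `H(n) ≠ 0` since `#H(n) = #H^*(n)`, and one prime of `hprime` makes `#H^*` drop,
  `CoreRankZero.card_dualSelmerGroup_atLevel_insert_lt`); `…_of_selfDual` — the prime choice for PAIRS
  of classes of `H¹(K, T̄)` only, through a residual self-duality `θ, θ′`
  (`CoreRankOne.hprime_of_localization_pair_infinite`);
* §2 `kummer_exists_isLevel_selmerGroup_eq_bot` — `T̄ = E[p]` over a number field, `p` odd,
  `𝓚 = kummerSelmerStructure p`: `χ(𝓚) = 0` by the Weil self-duality count
  (`natCard_selmerGroup_kummer_eq_dual`, CONDITIONAL on Tate's `hEP` as there), `θ′ = weilDualInv`;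
  conclusion `∃ d, D.IsLevel d ∧ #d < #Sel⁽ᵖ⁾(E/K) ∧ H¹_{𝓚(d)}(K, E[p]) = 0`;
* §3 `kummer_exists_isLevel_selmerGroup_eq_bot_three_deep_of_towerSurj` — `K = ℚ`, `p = 3`, the
  `3`-adic tower onto, and a Kolyvagin datum `D₁` on `E[3]` whose primes ARE the DEEP class
  `frobeniusClassPrimes (E[3^{k+1}]) S τ 3^{k+1}` (`τ ∈ Gal(ℚ̄/ℚ(μ_{3^{k+1}}))`, `E[3]/(τ−1) ≅ ℤ/3`)
  with cyclotomic transverse conditions: Rubin's local shape at the deep primes by cell n1011's deep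
  adapters (`S24Deep.natCard_unramifiedSubgroup_toLocal_of_mem_frobeniusClassPrimes_deep`, …), the
  prime choice by the tree's PROVED Chebotarev on the deep class
  (`PrimeChoice.infinite_setOf_mem_frobeniusClassPrimes_forall_localization_ne_zero_deep`, (H.1) from
  `ρ̄_{E,3}` onto, (H.3) `hH3_three_of_towerSurj`) ⟹ **a level `d` of the deep class with
  `H¹_{𝓚(d)}(ℚ, E[3]) = 0` and `#d < #Sel⁽³⁾(E/ℚ)`** — the bound uniform in the depth `k`.
Remaining binders (all named, none minted): the Poitou–Tate family at `3` (`IsPerfect`,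
`SumLocalTermEqZero`, `SelmerComplement`), Tate's local Euler characteristic `hEP` (a THEOREM over `ℚ`,
`localEulerPoincareCharacteristic_rat`, left to the consumer's spelling), the admissible finite set `S`.
The cartesian lift to `E[3^{k+1}]` and the conversion to `EndRow`'s `hinj`/`hord` are sequel files.
[cite: Rubin2011, Prop. 2.7.1, Cor. 2.7.3 and Cor. 2.7.4 (pp. 23–24)] [cite: MazurRubin2004, Cor. 4.1.9 (p. 38)]
[cite: Sakamoto2024, Lemma 5.2 and Cor. 5.5 (pp. 928–930)] [cite: SilvermanAEC2009, Prop. III.8.1, Thm. X.4.2 (b)]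
-/

set_option autoImplicit false
-- the Theorems namespace of a single-conjunct summit repeats the summit name by design (D-0017)
set_option linter.dupNamespace false

noncomputable section

open scoped Classical NumberField ContRepresentation
open Function Field NumberField IsDedekindDomain WeierstrassCurve
  Literature.NumberTheory.EllipticCurves
  Literature.NumberTheory.GaloisRepresentations
  Literature.NumberTheory.GaloisRepresentations.DiscreteGaloisModule Literature.NumberTheory.GaloisCohomology
  Summit.BirchSwinnertonDyer.Rank1Residual.GaloisImage
  Summit.BirchSwinnertonDyer.Rank1Residual.GaloisImage.CoreRankZero
  Summit.BirchSwinnertonDyer.Rank1Residual.X11b.LocBridge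

universe u

namespace Summit.BirchSwinnertonDyer.BirchSwinnertonDyer.Theorems.KimAtThreeDeepUpperCoreVertexKummer

namespace CoreVertex

/-! ## §1. Core vertices above every level at core rank ZERO, with the uniform bound -/

section Generic

variable {K : Type u} [Field K] [NumberField K]
variable {M : Type u} [AddCommGroup M] [TopologicalSpace M] [DiscreteTopology M] [Finite M]
variable {ρ : DiscreteGaloisModule K M}

/-- **Core vertices above every level at core rank zero, with the bound** (Rubin Cor. 2.7.3–2.7.4 at
`χ = 0`, `m = 1`).  `T̄` killed by the prime `p`, `𝓕` unramified outside `S` with finite Selmer and dual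
Selmer groups and `χ(𝓕) = 0` (`#H¹_𝓕 = #H¹_{𝓕^*}`), a Kolyvagin datum with primes off `S` and Rubin's
local shape (`#H¹_ur = #𝒯_𝔮 = p`, `H¹ = H¹_ur + 𝒯_𝔮`), and the mixed prime choice `hprime` (a class
of `H¹_{𝓕(d)}` and a dual class, seen by a fresh prime of the datum): for every level `n` there is a
level `d ⊇ n` with `H¹_{𝓕(d)}(K, T̄) = 0`, `H¹_{𝓕(d)^*}(K, T̄^D) = 0` and
`#d + 1 ≤ #n + #H¹_{𝓕(n)^*}(K, T̄^D)`.  Induction on `#H¹_{𝓕(n)^*}`: at `χ = 0` one has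
`#H(n) = #H^*(n)` at every level (`card_selmerGroup_atLevel_mul`), so `H^*(n) ≠ 0` yields classes on
both sides and a prime with `#H^*(n𝔮) < #H^*(n)` (`card_dualSelmerGroup_atLevel_insert_lt`).
[cite: Rubin2011, Cor. 2.7.3 and Cor. 2.7.4 (p. 24)] [cite: MazurRubin2004, Cor. 4.1.9 (p. 38)] -/
theorem exists_isLevel_selmerGroup_eq_bot_of_hasCoreRank_zero {p : ℕ} [Fact p.Prime]
    {inv : LocalInvariants K p}
    (hperf : inv.IsPerfect) (hsum : inv.SumLocalTermEqZero) (hcompl : inv.SelmerComplement)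
    (hM : ∀ m : M, p • m = 0) {S : Finset (Place K)}
    (hS : ∀ v : HeightOneSpectrum (𝓞 K), (Sum.inr v : Place K) ∉ S →
      ((p : ℕ) : 𝓞 K) ∉ v.asIdeal ∧ GaloisRep.IsUnramifiedAt v ρ)
    {𝓕 : SelmerStructure ρ} (h𝓕 : 𝓕.IsUnramifiedOutside S)
    (hfin : Finite 𝓕.selmerGroup) (hfind : Finite (inv.dualSelmerStructure ρ 𝓕).selmerGroup)
    (hχ : LocalInvariants.HasCoreRank inv 𝓕 p 0)
    {D : KolyvaginDatum ρ} (hPS : ∀ q ∈ D.primes, (Sum.inr q : Place K) ∉ S)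
    (hU : ∀ q ∈ D.primes, Nat.card (unramifiedSubgroup (GaloisRep.toLocal q ρ) 1) = p)
    (hT : ∀ q ∈ D.primes, Nat.card (D.transverse (Sum.inr q)) = p)
    (hUT : ∀ q ∈ D.primes,
      unramifiedSubgroup (GaloisRep.toLocal q ρ) 1 ⊔ D.transverse (Sum.inr q) = ⊤)
    (hprime : ∀ d, D.IsLevel d → ∀ c ∈ (D.atLevel 𝓕 d).selmerGroup,
      ∀ c' ∈ (inv.dualSelmerStructure ρ (D.atLevel 𝓕 d)).selmerGroup, c ≠ 0 → c' ≠ 0 →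
        ∃ q ∈ D.primes, q ∉ d ∧ galoisCohomology.localization ρ (Sum.inr q) 1 c ≠ 0 ∧
          galoisCohomology.localization (ρ.tateDual p) (Sum.inr q) 1 c' ≠ 0)
    {n : Finset (HeightOneSpectrum (𝓞 K))} (hn : D.IsLevel n) :
    ∃ d, n ⊆ d ∧ D.IsLevel d ∧
      d.card + 1 ≤ n.card + Nat.card (inv.dualSelmerStructure ρ (D.atLevel 𝓕 n)).selmerGroup ∧
      (D.atLevel 𝓕 d).selmerGroup = ⊥ ∧ (inv.dualSelmerStructure ρ (D.atLevel 𝓕 d)).selmerGroup = ⊥ := by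
  have hp : p.Prime := Fact.out
  -- `#H(d) = #H^*(d)` at every level (`χ = 0` is preserved along the levels)
  have hcount : ∀ d, D.IsLevel d →
      Nat.card (D.atLevel 𝓕 d).selmerGroup =
        Nat.card (inv.dualSelmerStructure ρ (D.atLevel 𝓕 d)).selmerGroup := by
    intro d hd
    have hmul := card_selmerGroup_atLevel_mul hperf hsum hcompl hM hS h𝓕 hfin hfind hPS
      (fun q hq => by rw [hU q hq, hT q hq]) hd
    rw [LocalInvariants.HasCoreRank, pow_zero, one_mul] at hχ
    rw [← hχ] at hmul
    have hF : Nat.card 𝓕.selmerGroup ≠ 0 := Nat.card_pos.ne'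
    refine mul_right_cancel₀ hF ?_
    rw [hmul, mul_comm]
  suffices h : ∀ (N : ℕ) (n : Finset (HeightOneSpectrum (𝓞 K))), D.IsLevel n →
      Nat.card (inv.dualSelmerStructure ρ (D.atLevel 𝓕 n)).selmerGroup = N →
        ∃ d, n ⊆ d ∧ D.IsLevel d ∧ d.card + 1 ≤ n.card + N ∧
          (D.atLevel 𝓕 d).selmerGroup = ⊥ ∧
            (inv.dualSelmerStructure ρ (D.atLevel 𝓕 d)).selmerGroup = ⊥ from
    h _ n hn rfl
  intro N
  induction N using Nat.strong_induction_on with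
  | _ N ih =>
    intro n hn hN
    haveI := finite_selmerGroup_atLevel D 𝓕 hfin n
    haveI := finite_dualSelmerGroup_atLevel inv D 𝓕 hfind n
    by_cases hbot : (inv.dualSelmerStructure ρ (D.atLevel 𝓕 n)).selmerGroup = ⊥
    · -- `n` itself: `H^*(n) = 0`, hence `H(n) = 0` by the count
      have h1 : Nat.card (D.atLevel 𝓕 n).selmerGroup = 1 := by
        rw [hcount n hn, hbot, AddSubgroup.card_bot]
      refine ⟨n, subset_rfl, hn, ?_, AddSubgroup.card_eq_one.1 h1, hbot⟩
      rw [← hN, hbot, AddSubgroup.card_bot]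
    · obtain ⟨y, hy, hy0⟩ := (AddSubgroup.bot_or_exists_ne_zero _).resolve_left hbot
      -- `H(n) ≠ 0` since `#H(n) = #H^*(n) > 1`
      have hne : (D.atLevel 𝓕 n).selmerGroup ≠ ⊥ := by
        intro h
        apply hbot
        apply AddSubgroup.card_eq_one.1
        rw [← hcount n hn, h, AddSubgroup.card_bot]
      obtain ⟨x, hx, hx0⟩ := (AddSubgroup.bot_or_exists_ne_zero _).resolve_left hne
      obtain ⟨q, hq, hqn, hxq, hyq⟩ := hprime n hn x hx y hy hx0 hy0
      have hlt := card_dualSelmerGroup_atLevel_insert_lt hperf hsum hcompl hM hS h𝓕 hfin hfind hPS hU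
        hUT n hq hqn hx hxq hy hyq
      obtain ⟨d, hnd, hd, hcard, hSel, hcore⟩ := ih _ (hN ▸ hlt) (insert q n) (hn.insert hq) rfl
      refine ⟨d, (Finset.subset_insert q n).trans hnd, hd, ?_, hSel, hcore⟩
      rw [Finset.card_insert_of_notMem hqn] at hcard
      omega

variable {p : ℕ} (θ : ρ.toContRepresentation →ⁱL (ρ.tateDual p).toContRepresentation)
  (θ' : (ρ.tateDual p).toContRepresentation →ⁱL ρ.toContRepresentation)

/-- **The same with the prime choice for PAIRS of classes of `H¹(K, T̄)` only**, through a residual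
self-duality `θ : T̄ → T̄^D` with two-sided inverse `θ′` (Sakamoto's (H.SD); for `T̄ = E[p]` the Weil
pairing): `hprime` follows from "any two non-zero classes of `H¹(K, T̄)` are both seen by infinitely
many primes of the datum" (`CoreRankOne.hprime_of_localization_pair_infinite`).
[cite: Sakamoto2024, Cor. 5.5 (p. 929)] [cite: Rubin2011, Prop. 2.7.1 and Cor. 2.7.3 (pp. 23–24)] -/
theorem exists_isLevel_selmerGroup_eq_bot_of_hasCoreRank_zero_of_selfDual [Fact p.Prime]
    (hθ'θ : ∀ b, θ (θ' b) = b) {inv : LocalInvariants K p}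
    (hperf : inv.IsPerfect) (hsum : inv.SumLocalTermEqZero) (hcompl : inv.SelmerComplement)
    (hM : ∀ m : M, p • m = 0) {S : Finset (Place K)}
    (hS : ∀ v : HeightOneSpectrum (𝓞 K), (Sum.inr v : Place K) ∉ S →
      ((p : ℕ) : 𝓞 K) ∉ v.asIdeal ∧ GaloisRep.IsUnramifiedAt v ρ)
    {𝓕 : SelmerStructure ρ} (h𝓕 : 𝓕.IsUnramifiedOutside S)
    (hfin : Finite 𝓕.selmerGroup) (hfind : Finite (inv.dualSelmerStructure ρ 𝓕).selmerGroup)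
    (hχ : LocalInvariants.HasCoreRank inv 𝓕 p 0)
    {D : KolyvaginDatum ρ} (hPS : ∀ q ∈ D.primes, (Sum.inr q : Place K) ∉ S)
    (hU : ∀ q ∈ D.primes, Nat.card (unramifiedSubgroup (GaloisRep.toLocal q ρ) 1) = p)
    (hT : ∀ q ∈ D.primes, Nat.card (D.transverse (Sum.inr q)) = p)
    (hUT : ∀ q ∈ D.primes,
      unramifiedSubgroup (GaloisRep.toLocal q ρ) 1 ⊔ D.transverse (Sum.inr q) = ⊤)
    (hch : ∀ c₁ c₂ : galoisCohomology ρ 1, c₁ ≠ 0 → c₂ ≠ 0 →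
      {q ∈ D.primes | galoisCohomology.localization ρ (Sum.inr q) 1 c₁ ≠ 0 ∧
        galoisCohomology.localization ρ (Sum.inr q) 1 c₂ ≠ 0}.Infinite)
    {n : Finset (HeightOneSpectrum (𝓞 K))} (hn : D.IsLevel n) :
    ∃ d, n ⊆ d ∧ D.IsLevel d ∧
      d.card + 1 ≤ n.card + Nat.card (inv.dualSelmerStructure ρ (D.atLevel 𝓕 n)).selmerGroup ∧
      (D.atLevel 𝓕 d).selmerGroup = ⊥ ∧ (inv.dualSelmerStructure ρ (D.atLevel 𝓕 d)).selmerGroup = ⊥ :=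
  exists_isLevel_selmerGroup_eq_bot_of_hasCoreRank_zero hperf hsum hcompl hM hS h𝓕 hfin hfind hχ hPS hU
    hT hUT (CoreRankOne.hprime_of_localization_pair_infinite θ θ' hθ'θ hch) hn

end Generic

/-! ## §2. The classical structure `𝓚` on `E[p]`, `p` odd: `χ(𝓚) = 0` by the Weil pairing -/

section Kummer

variable {K : Type u} [Field K] [NumberField K]

/-- **Residual core vertices of the classical `p`-descent structure.**  `E` elliptic over a number
field `K`, `p` an odd prime, `𝓚 = kummerSelmerStructure p` (Selmer group `Sel⁽ᵖ⁾(E/K)`, finite), a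
Poitou–Tate family at `p`, Tate's local Euler characteristic `hEP`, `S ⊇ ∞ ∪ {v ∣ p} ∪ Ram(E[p])` with
`𝓚` unramified outside `S`, a Kolyvagin datum `D` on `E[p]` with primes off `S` and Rubin's local shape,
and the pair prime choice `hch` over `H¹(K, E[p])`: **there is a level `d` of `D` with
`H¹_{𝓚(d)}(K, E[p]) = 0` and `#d < #Sel⁽ᵖ⁾(E/K)`.**  `χ(𝓚) = 0` is the Weil self-duality count
(`natCard_selmerGroup_kummer_eq_dual`); the dual class is transported by the inverse Weil map
(`weilDualInv`, injective on `H¹` by `map_weilDual_map_weilDualInv`); then §1 at `n = ∅`.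
[cite: Rubin2011, Cor. 2.7.3 (p. 24)] [cite: SilvermanAEC2009, Prop. III.8.1] [cite: MilneADT2006, Ch. I, Thm. 2.8] -/
theorem kummer_exists_isLevel_selmerGroup_eq_bot (W : WeierstrassCurve K) [W.IsElliptic]
    (p : ℕ) [Fact p.Prime] (hp2 : p ≠ 2) [Finite (geomTorsion W (p : ℤ))]
    {inv : LocalInvariants K p}
    (hperf : inv.IsPerfect) (hsum : inv.SumLocalTermEqZero) (hcompl : inv.SelmerComplement)
    (hEP : ∀ v : HeightOneSpectrum (𝓞 K), localEulerPoincareCharacteristic (v.adicCompletion K))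
    {S : Finset (Place K)}
    (hS : ∀ v : HeightOneSpectrum (𝓞 K), (Sum.inr v : Place K) ∉ S →
      ((p : ℕ) : 𝓞 K) ∉ v.asIdeal ∧ GaloisRep.IsUnramifiedAt v (W.torsionGaloisModule (p : ℤ)))
    (h𝓚 : (W.kummerSelmerStructure (p : ℤ)).IsUnramifiedOutside S)
    [hfin : Finite (W.kummerSelmerStructure (p : ℤ)).selmerGroup]
    {D : KolyvaginDatum (W.torsionGaloisModule (p : ℤ))}
    (hPS : ∀ q ∈ D.primes, (Sum.inr q : Place K) ∉ S)
    (hU : ∀ q ∈ D.primes,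
      Nat.card (unramifiedSubgroup (GaloisRep.toLocal q (W.torsionGaloisModule (p : ℤ))) 1) = p)
    (hT : ∀ q ∈ D.primes, Nat.card (D.transverse (Sum.inr q)) = p)
    (hUT : ∀ q ∈ D.primes,
      unramifiedSubgroup (GaloisRep.toLocal q (W.torsionGaloisModule (p : ℤ))) 1 ⊔
        D.transverse (Sum.inr q) = ⊤)
    (hch : ∀ c₁ c₂ : galoisCohomology (W.torsionGaloisModule (p : ℤ)) 1, c₁ ≠ 0 → c₂ ≠ 0 →
      {q ∈ D.primes |
        galoisCohomology.localization (W.torsionGaloisModule (p : ℤ)) (Sum.inr q) 1 c₁ ≠ 0 ∧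
        galoisCohomology.localization (W.torsionGaloisModule (p : ℤ)) (Sum.inr q) 1 c₂ ≠ 0}.Infinite) :
    ∃ d, D.IsLevel d ∧ d.card < Nat.card (W.kummerSelmerStructure (p : ℤ)).selmerGroup ∧
      (D.atLevel (W.kummerSelmerStructure (p : ℤ)) d).selmerGroup = ⊥ := by
  have hp : p.Prime := Fact.out
  haveI : NeZero p := ⟨hp.ne_zero⟩
  obtain ⟨e, hμ, hadd₁, hadd₂, halt, hnondeg, hgal⟩ :=
    exists_weilPairing_holds W p hp.two_le (Nat.cast_ne_zero.2 hp.ne_zero)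
  have hinv : ∀ v : HeightOneSpectrum (𝓞 K), Injective (inv (Sum.inr v)) := fun v => (hperf v).1.1
  have hM : ∀ m : geomTorsion W (p : ℤ), p • m = 0 := fun T => AddSubgroup.torsionBy.nsmul T
  -- `χ(𝓚) = 0`: the residual self-duality count
  have hcount := natCard_selmerGroup_kummer_eq_dual W p e hμ hadd₁ hadd₂ hgal halt hnondeg hp.isPrimePow
    (hp.odd_of_ne_two hp2) inv hinv hEP
  have hχ : LocalInvariants.HasCoreRank inv (W.kummerSelmerStructure (p : ℤ)) p 0 := by
    rw [LocalInvariants.HasCoreRank, pow_zero, one_mul]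
    exact hcount
  have hfind : Finite (inv.dualSelmerStructure (W.torsionGaloisModule (p : ℤ))
      (W.kummerSelmerStructure (p : ℤ))).selmerGroup := by
    apply Nat.finite_of_card_ne_zero
    rw [← hcount]
    exact Nat.card_pos.ne'
  -- the inverse Weil transport is injective on `H¹`
  have hθ'θ : ∀ b, weilDualIntertwining W p e hμ hadd₁ hadd₂ hgal
      (weilDualInv W p e hμ hadd₁ hadd₂ hgal hnondeg b) = b :=
    weilDualIntertwining_weilDualInv W p e hμ hadd₁ hadd₂ hgal hnondeg
  obtain ⟨d, -, hd, hcard, hSel, -⟩ :=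
    exists_isLevel_selmerGroup_eq_bot_of_hasCoreRank_zero_of_selfDual
      (weilDualIntertwining W p e hμ hadd₁ hadd₂ hgal) (weilDualInv W p e hμ hadd₁ hadd₂ hgal hnondeg)
      hθ'θ hperf hsum hcompl hM hS h𝓚 hfin hfind hχ hPS hU hT hUT hch D.isLevel_empty
  refine ⟨d, hd, ?_, hSel⟩
  have h0 : D.atLevel (W.kummerSelmerStructure (p : ℤ)) ∅ = W.kummerSelmerStructure (p : ℤ) :=
    SelmerStructure.modify_empty _ _
  rw [h0, ← hcount, Finset.card_empty, zero_add] at hcard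
  omega

end Kummer

/-! ## §3. Over `ℚ` at `p = 3` under the tower, primes in the DEEP Frobenius class -/

section Deep

variable (W : WeierstrassCurve ℚ) [W.IsElliptic]

/-- **Residual core vertices of `𝓚` inside the deep class, under the `3`-adic tower.**  `E/ℚ` with
`ρ_{E,3^n}` onto for all `n`, a Poitou–Tate family at `3`, Tate's `hEP`, a finite set of places
`S ⊇ ∞ ∪ {3} ∪ Ram(E[3])` with `𝓚 = kummerSelmerStructure 3` unramified outside `S`, a depth `k`,
`τ ∈ Gal(ℚ̄/ℚ(μ_{3^{k+1}}))` with `E[3]/(τ − 1)E[3] ≅ ℤ/3`, and a Kolyvagin datum `D₁` on `E[3]` with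
`D₁.primes = frobeniusClassPrimes (E[3^{k+1}]) {v | v ∈ S} τ 3^{k+1}` (the DEEP class) and cyclotomic
transverse conditions: **there is a level `d` of `D₁` — a finite set of deep-class primes — with
`H¹_{𝓚(d)}(ℚ, E[3]) = 0` and `#d < #Sel⁽³⁾(E/ℚ)`** (uniform in `k`).  Rubin's local shape on the deep
class: n1011 `S24Deep.natCard_unramifiedSubgroup_toLocal_of_mem_frobeniusClassPrimes_deep`,
`…natCard_cyclotomicTransverse_of_mem_frobeniusClassPrimes_deep`,
`unramifiedSubgroup_sup_cyclotomicTransverse_eq_top_of_mem_frobeniusClassPrimes` (the located input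
`modPCyclotomicCharacter_surjOn_absInertia_rat_holds`); the pair prime choice:
`PrimeChoice.infinite_setOf_mem_frobeniusClassPrimes_forall_localization_ne_zero_deep` with (H.1) from
surj(3) and (H.3) `hH3_three_of_towerSurj`; `Sel⁽³⁾(E/ℚ)` finite (Silverman X.4.2 (b)).
[cite: Sakamoto2024, Lemma 5.2 and Cor. 5.5 (pp. 928–930)] [cite: Rubin2011, Prop. 1.4.13 (1), Prop. 1.9.5, Cor. 2.7.3]
[cite: MazurRubin2004, Prop. 3.6.1 (pp. 30–31) and Cor. 4.1.9 (p. 38)] -/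
theorem kummer_exists_isLevel_selmerGroup_eq_bot_three_deep_of_towerSurj
    (htower : ∀ n : ℕ, W.HasSurjectiveModNGaloisRep (3 ^ n : ℕ))
    {inv : LocalInvariants ℚ 3}
    (hperf : inv.IsPerfect) (hsum : inv.SumLocalTermEqZero) (hcompl : inv.SelmerComplement)
    (hEP : ∀ v : HeightOneSpectrum (𝓞 ℚ), localEulerPoincareCharacteristic (v.adicCompletion ℚ))
    {S : Finset (Place ℚ)}
    (hS : ∀ v : HeightOneSpectrum (𝓞 ℚ), (Sum.inr v : Place ℚ) ∉ S →
      ((3 : ℕ) : 𝓞 ℚ) ∉ v.asIdeal ∧ GaloisRep.IsUnramifiedAt v (W.torsionGaloisModule ((3 : ℕ) : ℤ)))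
    (h𝓚 : (W.kummerSelmerStructure ((3 : ℕ) : ℤ)).IsUnramifiedOutside S)
    (k : ℕ) {τ : absoluteGaloisGroup ℚ} (hτμ : τ ∈ rootsOfUnityFixer ℚ (3 ^ (k + 1)))
    (hτ : Nonempty (cokerSubOne (W.torsionGaloisModule ((3 : ℕ) : ℤ)) τ ≃+ ZMod 3))
    {D₁ : KolyvaginDatum (W.torsionGaloisModule ((3 : ℕ) : ℤ))}
    (hP : D₁.primes = frobeniusClassPrimes (W.torsionGaloisModule (((3 : ℕ) : ℤ) ^ k * ((3 : ℕ) : ℤ)))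
      {v | (Sum.inr v : Place ℚ) ∈ S} τ (3 ^ (k + 1)))
    (hDT : D₁.transverse = cyclotomicTransverse (W.torsionGaloisModule ((3 : ℕ) : ℤ))) :
    haveI : Fact (Nat.Prime 3) := ⟨Nat.prime_three⟩
    ∃ d, D₁.IsLevel d ∧ d.card < Nat.card (W.kummerSelmerStructure ((3 : ℕ) : ℤ)).selmerGroup ∧
      (D₁.atLevel (W.kummerSelmerStructure ((3 : ℕ) : ℤ)) d).selmerGroup = ⊥ := by
  haveI : Fact (Nat.Prime 3) := ⟨Nat.prime_three⟩
  haveI : NeZero ((3 : ℕ) : ℚ) := ⟨by norm_num⟩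
  haveI : NeZero (3 ^ (k + 1)) := ⟨pow_ne_zero _ three_ne_zero⟩
  -- finiteness of the modules and of `Sel⁽³⁾(E/ℚ)` (Silverman X.4.2 (b))
  haveI : Finite (geomTorsion W ((3 : ℕ) : ℤ)) :=
    finite_torsionPoints_holds W (AlgebraicClosure ℚ) (by norm_num)
  haveI : Finite (geomTorsion W (((3 : ℕ) : ℤ) ^ k * ((3 : ℕ) : ℤ))) :=
    finite_torsionPoints_holds W (AlgebraicClosure ℚ) (by positivity)
  haveI hfin : Finite (W.kummerSelmerStructure ((3 : ℕ) : ℤ)).selmerGroup := by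
    rw [← selmerGroup_eq_selmerGroup_kummerSelmerStructure]
    exact W.finite_selmerGroup_holds (by norm_num)
  have hM : ∀ m : geomTorsion W ((3 : ℕ) : ℤ), (3 : ℕ) • m = 0 := fun T => AddSubgroup.torsionBy.nsmul T
  -- kernel inclusion `E[3] ⊆ E[3^{k+1}]` and the class inclusion `𝒫′ ⊆ 𝒫`
  have hker : ∀ u : absoluteGaloisGroup ℚ, (W.torsionGaloisModule (((3 : ℕ) : ℤ) ^ k * ((3 : ℕ) : ℤ))) u = 1 → (W.torsionGaloisModule ((3 : ℕ) : ℤ)) u = 1 := fun u hu =>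
    S24Deep.torsionGaloisModule_eq_one_of_dvd W (Dvd.intro_left _ rfl) u hu
  have hNN' : 3 ∣ 3 ^ (k + 1) := dvd_pow_self 3 (Nat.succ_ne_zero k)
  have hτμ₁ : τ ∈ rootsOfUnityFixer ℚ 3 := rootsOfUnityFixer_le_of_dvd ℚ hNN' hτμ
  -- primes of the datum: off `S`, with Rubin's local shape
  have hPS : ∀ q ∈ D₁.primes, (Sum.inr q : Place ℚ) ∉ S := fun q hq => by
    rw [hP] at hq
    exact hq.1
  have hU : ∀ q ∈ D₁.primes, Nat.card (unramifiedSubgroup (GaloisRep.toLocal q (W.torsionGaloisModule ((3 : ℕ) : ℤ))) 1) = 3 := by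
    intro q hq
    rw [hP] at hq
    exact S24Deep.natCard_unramifiedSubgroup_toLocal_of_mem_frobeniusClassPrimes_deep (W.torsionGaloisModule ((3 : ℕ) : ℤ)) (W.torsionGaloisModule (((3 : ℕ) : ℤ) ^ k * ((3 : ℕ) : ℤ))) 3 (3 ^ (k + 1))
      hker hNN' hτ hq
  have hT : ∀ q ∈ D₁.primes, Nat.card (D₁.transverse (Sum.inr q)) = 3 := by
    intro q hq
    rw [hP] at hq
    rw [hDT]
    exact S24Deep.natCard_cyclotomicTransverse_of_mem_frobeniusClassPrimes_deep (W.torsionGaloisModule ((3 : ℕ) : ℤ)) (W.torsionGaloisModule (((3 : ℕ) : ℤ) ^ k * ((3 : ℕ) : ℤ))) 3 (3 ^ (k + 1))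
      hker hNN' hτμ hτ hM hq
  have hUT : ∀ q ∈ D₁.primes,
      unramifiedSubgroup (GaloisRep.toLocal q (W.torsionGaloisModule ((3 : ℕ) : ℤ))) 1 ⊔ D₁.transverse (Sum.inr q) = ⊤ := by
    intro q hq
    rw [hP] at hq
    have hq₁ : q ∈ frobeniusClassPrimes (W.torsionGaloisModule ((3 : ℕ) : ℤ)) {v | (Sum.inr v : Place ℚ) ∈ S} τ 3 :=
      S24Deep.frobeniusClassPrimes_mono (W.torsionGaloisModule ((3 : ℕ) : ℤ)) (W.torsionGaloisModule (((3 : ℕ) : ℤ) ^ k * ((3 : ℕ) : ℤ))) hker _ τ hNN' hq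
    haveI : Fact (Ideal.absNorm q.asIdeal).Prime := ⟨Literature.NumberTheory.Automorphic.Ash2003.residueCard_prime q⟩
    haveI : CharZero (q.adicCompletion ℚ) :=
      charZero_of_injective_algebraMap (algebraMap ℚ (q.adicCompletion ℚ)).injective
    haveI : NeZero ((Ideal.absNorm q.asIdeal : ℕ) : q.adicCompletion ℚ) :=
      ⟨Nat.cast_ne_zero.2 (Literature.NumberTheory.Automorphic.Ash2003.residueCard_prime q).ne_zero⟩
    rw [hDT]
    exact unramifiedSubgroup_sup_cyclotomicTransverse_eq_top_of_mem_frobeniusClassPrimes (W.torsionGaloisModule ((3 : ℕ) : ℤ)) hq₁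
      (absNorm_sub_one_smul_eq_zero_of_mem_frobeniusClassPrimes (W.torsionGaloisModule ((3 : ℕ) : ℤ)) hq₁ hτμ₁ hM)
      (modPCyclotomicCharacter_surjOn_absInertia_rat_holds q)
  -- the pair prime choice on the deep class (Chebotarev, (H.1), (H.3))
  have hirr := hasIrreducibleModPGaloisRep_of_hasSurjectiveModNGaloisRep W 3 (by simpa using htower 1)
  have hbadfin : ({v : HeightOneSpectrum (𝓞 ℚ) | (Sum.inr v : Place ℚ) ∈ S}).Finite :=
    (S.finite_toSet.preimage fun v _ w _ h => Sum.inr_injective h)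
  have hch : ∀ c₁ c₂ : galoisCohomology (W.torsionGaloisModule ((3 : ℕ) : ℤ)) 1, c₁ ≠ 0 → c₂ ≠ 0 →
      {q ∈ D₁.primes | galoisCohomology.localization (W.torsionGaloisModule ((3 : ℕ) : ℤ)) (Sum.inr q) 1 c₁ ≠ 0 ∧
        galoisCohomology.localization (W.torsionGaloisModule ((3 : ℕ) : ℤ)) (Sum.inr q) 1 c₂ ≠ 0}.Infinite := by
    intro c₁ c₂ hc₁ hc₂
    have hInf :=
      PrimeChoice.infinite_setOf_mem_frobeniusClassPrimes_forall_localization_ne_zero_deep (W.torsionGaloisModule ((3 : ℕ) : ℤ)) (W.torsionGaloisModule (((3 : ℕ) : ℤ) ^ k * ((3 : ℕ) : ℤ))) hker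
        (p := 3) (N' := 3 ^ (k + 1)) (pow_ne_zero _ (by norm_num)) _ hbadfin hτ
        (fun A hA => hirr A fun σ P hP => hA σ P hP) (hH3_three_of_towerSurj W k htower)
        (n := 2) (by norm_num) ![c₁, c₂] (fun i => by fin_cases i <;> simpa)
    rw [hP]
    refine hInf.mono ?_
    rintro q ⟨hq, hloc⟩
    exact ⟨hq, by simpa using hloc 0, by simpa using hloc 1⟩
  exact kummer_exists_isLevel_selmerGroup_eq_bot W 3 (by norm_num) hperf hsum hcompl hEP hS h𝓚 hPS hU
    hT hUT hch

end Deep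

end CoreVertex

end Summit.BirchSwinnertonDyer.BirchSwinnertonDyer.Theorems.KimAtThreeDeepUpperCoreVertexKummer

end
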